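import Mathlib
import Summits.Ventures.PercRepro2.SwOutSevKey
import Summits.Ventures.PercRepro2.SwOutSevOrbitThm
import Summits.Ventures.PercRepro2.SwOutSevEscBase

/-!
# The key and the blocks of a several-arms junction class (blind cell PercRepro2, night-4 g22,
2026-08-27; proofs/NIGHT4-G22.md §6)

THE KEY of a `Q`-point of a class with a several-arms junction (`keyR`): the all-red orientation
when `u` is outside the hull of `h` or the point is escaping of the plain kind; the DATA
`mixedDataR ζ` for a core-kind point; for an escaping point of the mixed kind (`MixedKindER`: it
lies in the block of a core-kind `Q`-point whose data are those read off the point through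
`baseER`) the data read off the point.  THE BLOCKS (`blockOfR`): the coarse orbit or the block
`blockR` of the data.  Also the connectivity of the arm sets of the data inside themselves
(`cluster_conn_within`, `dataU_conn_within`, …), the dead edges of the pieces (`dataAh_dead`),
the outside edges the escaping analysis needs (`dataExt`, `dataPieceOut`, `dataExtU`), the
realisation of the top point (`mixedRealR_top`) and the data of the canonical base
(`mixedDataR_coreBaseOf`).
-/

namespace Summit.Ventures.PercRepro2

namespace MixedArms

open Hull LocRows BigBlock

variable {V : Type*} {E : Type*} [Fintype E] [DecidableEq E]

open scoped Classical

section Conn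

variable {ends : E → Sym2 V}

omit [Fintype E] [DecidableEq E] in
/-- Two vertices of a cluster are connected inside the cluster. -/
lemma cluster_conn_within {ω : Config E} {z x y : V} (hx : x ∈ cluster ends ω z)
    (hy : y ∈ cluster ends ω z) :
    y ∈ cluster ends (fun e => decide (e ∈ within ends (cluster ends ω z))) x := by
  set S := cluster ends ω z with hS
  let T : Set V := cluster ends (fun e => decide (e ∈ within ends S)) x
  have hTS : ∀ v ∈ T, v ∈ S := by
    intro v hv
    refine mem_of_conn_of_closed (ends := ends) (ω := fun e => decide (e ∈ within ends S)) ?_ hx hv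
    intro a _ b hab
    obtain ⟨_, e, he, hends⟩ := openGraph_adj.1 hab
    simp only [decide_eq_true_eq] at he
    obtain ⟨x', hx', y', hy', h'⟩ := he
    rw [hends, Sym2.eq_iff] at h'
    rcases h' with ⟨_, rfl⟩ | ⟨_, rfl⟩
    · exact hy'
    · exact hx'
  have hclosed : ∀ a ∈ T, ∀ b, (openGraph ends ω).Adj a b → b ∈ T := by
    intro a ha b hab
    obtain ⟨_, e, he, hends⟩ := openGraph_adj.1 hab
    have haS : a ∈ S := hTS a ha
    have hbS : b ∈ S := mem_cluster_of_edge haS he hends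
    have he' : (fun e => decide (e ∈ within ends S)) e = true := by
      simp only [decide_eq_true_eq]
      exact ⟨a, haS, b, hbS, hends⟩
    exact mem_cluster_of_edge ha he' hends
  exact mem_of_conn_of_closed hclosed (mem_cluster_self _ _ _) (conn_trans (conn_symm hx) hy)

end Conn

variable {ends : E → Sym2 V} {ρ : Type*} [Fintype ρ] {U : Set V} {ξ : Config E} {l h o u : V}
  {p : ρ → V}

section Top

omit [DecidableEq E] in
/-- The base of the data. -/
lemma mixedDataR_base (ζ : Config E) : (mixedDataR ends h u p ζ).base = coreBaseOf ends ζ h u := rfl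

omit [Fintype E] [DecidableEq E] [Fintype ρ] in
/-- The top point realises the base. -/
lemma mixedRealR_top {ι ρ' ν κ : Type*} (σ : Config E) (U' : ι → Set V) (p' : ρ' → V)
    (Ah : ν → Set V) (F : κ → Set V) :
    mixedRealR ends u U' p' Ah F σ
      ((fun _ => true), (fun _ => true), (fun _ => true), (fun _ => true), fun _ => true) = σ := by
  funext e
  unfold mixedRealR
  rw [if_neg]
  rintro ((((⟨j, hj', -⟩ | ⟨i, hi, -⟩) | ⟨r, hr, -⟩) | ⟨r, hr, -⟩) | ⟨k, hk, -⟩)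
  · exact Bool.noConfusion hj'
  · exact Bool.noConfusion hi
  · exact Bool.noConfusion hr
  · exact Bool.noConfusion hr
  · exact Bool.noConfusion hk

end Top

section Data

variable (hj : MixedJunctionR ends U h u p o)
include hj

omit [DecidableEq E] in
/-- A u-arm set of the data is connected inside itself. -/
lemma dataU_conn_within (ζ : Config E) (j : (mixedDataR ends h u p ζ).ι) :
    ∀ x ∈ (mixedDataR ends h u p ζ).U j, ∀ y ∈ (mixedDataR ends h u p ζ).U j,
      y ∈ cluster ends (fun e => decide (e ∈ within ends ((mixedDataR ends h u p ζ).U j))) x := by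
  obtain ⟨z, -, -, -, hz⟩ := exists_of_mem_armsC (dataU_mem_armsC hj j)
  intro x hx y hy
  rw [hz] at hx hy ⊢
  exact cluster_conn_within hx hy

omit hj in
omit [DecidableEq E] in
/-- A far arm of the data is connected inside itself. -/
lemma dataF_conn_within (ζ : Config E) (k : (mixedDataR ends h u p ζ).κ) :
    ∀ x ∈ (mixedDataR ends h u p ζ).F k, ∀ y ∈ (mixedDataR ends h u p ζ).F k,
      y ∈ cluster ends (fun e => decide (e ∈ within ends ((mixedDataR ends h u p ζ).F k))) x := by
  obtain ⟨z, -, -, -, hz⟩ := exists_of_mem_armsC (dataF_mem_armsC (ends := ends) (h := h) (u := u) (p := p) (ζ := ζ) k)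
  intro x hx y hy
  change k.1 = armC ends h u ζ z at hz
  change x ∈ k.1 at hx
  change y ∈ k.1 at hy
  show y ∈ cluster ends (fun e => decide (e ∈ within ends k.1)) x
  rw [hz] at hx hy ⊢
  exact cluster_conn_within hx hy

omit hj in
omit [DecidableEq E] in
/-- A piece of the data is connected inside itself. -/
lemma dataAh_conn_within (ζ : Config E) (i : (mixedDataR ends h u p ζ).ν) :
    ∀ x ∈ (mixedDataR ends h u p ζ).Ah i, ∀ y ∈ (mixedDataR ends h u p ζ).Ah i,
      y ∈ cluster ends (fun e => decide (e ∈ within ends ((mixedDataR ends h u p ζ).Ah i))) x := by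
  obtain ⟨-, z, -, hz⟩ := exists_pieceC_of_mem_piecesR (Finset.mem_filter.1 i.2).1
  intro x hx y hy
  change x ∈ i.1.2 at hx
  change y ∈ i.1.2 at hy
  show y ∈ cluster ends (fun e => decide (e ∈ within ends i.1.2)) x
  rw [hz] at hx hy ⊢
  exact cluster_conn_within hx hy

omit hj in
omit [DecidableEq E] in
/-- Every piece of the data carries a dead edge. -/
lemma dataAh_dead (ζ : Config E) (i : (mixedDataR ends h u p ζ).ν) :
    ∃ e y, ends e = s((mixedDataR ends h u p ζ).drop p ((mixedDataR ends h u p ζ).arm i), y) ∧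
      y ∈ (mixedDataR ends h u p ζ).Ah i := by
  obtain ⟨-, y, hy, hi⟩ := exists_pieceC_of_mem_piecesR (Finset.mem_filter.1 i.2).1
  obtain ⟨e, y', hey', hy', hyy'⟩ := exists_dead_of_mem_AhOfR hy
  refine ⟨e, y', hey', ?_⟩
  show y' ∈ i.1.2
  rw [hi, pieceC_eq_of_mem hyy']
  exact mem_pieceC_self y'

variable (hl : l ∉ U) {ζ : Config E} (hζ : ζ ∈ swOutSide ends l h o U ξ) (hk : CoreKind ends U h u ζ)
include hl hζ hk

/-- The data of the canonical base are the data of the point. -/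
theorem mixedDataR_coreBaseOf : mixedDataR ends h u p (coreBaseOf ends ζ h u) = mixedDataR ends h u p ζ := by
  have := mixedDataR_realR_core hj hl hζ hk
    (q := (((fun _ => true), (fun _ => true), (fun _ => true), (fun _ => true), fun _ => true) :
      PtR (mixedDataR ends h u p ζ).ι (mixedDataR ends h u p ζ).ρ' (mixedDataR ends h u p ζ).ν
        (mixedDataR ends h u p ζ).κ))
    ⟨fun _ => rfl, fun _ => rfl⟩
  rwa [mixedRealR_top] at this

omit hl in
/-- The outside edge of a mixed dropped vertex, for the escaping analysis. -/
lemma dataExt (r : (mixedDataR ends h u p ζ).ρ') :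
    ∃ e y, ends e = s((mixedDataR ends h u p ζ).drop p r, y) ∧ y ∉ U ∧ y ≠ u ∧
      ∀ i, y ∉ (mixedDataR ends h u p ζ).Ah i := by
  have hHU : extHull ends ζ h u ⊆ U := extHull_subset_of_coreKind hζ hk
  have huU : u ∈ U := hk.2 (Or.inl (mem_cluster_self _ _ _))
  obtain ⟨e, y, hey, hyU⟩ := exists_ext_edge_R hj (fun r => hHU (p_mem_extHull (hj.hup r) ζ)) r.1
  refine ⟨e, y, hey, hyU, fun h' => hyU (h' ▸ huU), fun i hyi => ?_⟩
  exact hyU (hHU (mem_extHull_of_mem_armsAllR hj (Or.inl (Or.inr (Set.mem_iUnion.2 ⟨i, hyi⟩)))).1)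

omit [DecidableEq E] hl hζ hk in
/-- A neighbour of a mixed dropped vertex outside `u` and the pieces lies outside `U`. -/
lemma dataExtU (r : (mixedDataR ends h u p ζ).ρ') (e : E) (x : V)
    (hx : ends e = s((mixedDataR ends h u p ζ).drop p r, x)) (hxu : x ≠ u)
    (hxA : ∀ i, x ∉ (mixedDataR ends h u p ζ).Ah i) : x ∉ U := by
  intro hxU
  change ends e = s(p r.1, x) at hx
  obtain ⟨e', he'⟩ := hj.hp_adj_h r.1 e x hx hxU hxu
  have hxH : x ∈ extHull ends ζ h u := by
    cases hc : ζ e' with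
    | true => exact Or.inl (Or.inl (mem_cluster_of_edge (mem_cluster_self _ _ _) hc (ends_swap he')))
    | false =>
      have hc' : blue ζ e' = true := by rw [blue_eq_true_iff]; exact hc
      exact Or.inl (Or.inr (mem_cluster_of_edge (mem_cluster_self _ _ _) hc' (ends_swap he')))
  have hxA' : x ∈ AhOfR ends h u p ζ r.1 := mem_AhOfR_of_edge_p hj hx hxH hxu
  have hmem : (r.1, pieceC ends h u p ζ r.1 x) ∈
      (piecesR ends h u p ζ).filter fun x => x.1 ∈ mixedR ends h u p ζ :=
    Finset.mem_filter.2 ⟨mem_piecesR_of_mem_AhOfR' (mem_mixedR_iff.1 r.2) hxA', r.2⟩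
  exact hxA ⟨(r.1, pieceC ends h u p ζ r.1 x), hmem⟩ (mem_pieceC_self x)

/-- Every u–`p r` edge is red at the canonical base. -/
lemma dataP_red (r : ρ) (e : E) (he : ends e = s(u, p r)) : coreBaseOf ends ζ h u e = true :=
  (mixedBaseR_of_coreKindR hj hl hζ hk).u_red e (p r) he

/-- Every edge from a dropped vertex out of `U` is blue at the canonical base. -/
lemma dataP_blue (r : ρ) (e : E) (x : V) (he : ends e = s(p r, x)) (hxU : x ∉ U) :
    coreBaseOf ends ζ h u e = false := by
  have hb := mixedBaseR_of_coreKindR hj hl hζ hk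
  have hHU : extHull ends ζ h u ⊆ U := extHull_subset_of_coreKind hζ hk
  have huU : u ∈ U := hk.2 (Or.inl (mem_cluster_self _ _ _))
  have hxu : x ≠ u := fun h' => hxU (h' ▸ huU)
  have hxh : x ≠ h := fun h' => hxU (h' ▸ (mem_outClass.1 (mem_swOutSide.1 hζ).2).2
    (Or.inl (mem_cluster_self _ _ _)))
  have hxp : ∀ r', x ≠ p r' := fun r' h' => hxU (h' ▸ hHU (p_mem_extHull (hj.hup r') ζ))
  have hxA : x ∉ armsAllR (mixedDataR ends h u p ζ).U (mixedDataR ends h u p ζ).Ah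
      (mixedDataR ends h u p ζ).F := fun hx => hxU (hHU (mem_extHull_of_mem_armsAllR hj hx).1)
  by_cases hr : DeadBlueR ends h u p ζ r
  · -- a mixed arm: an outside edge of the base
    exact hb.ext_blue ⟨r, mem_mixedR_iff.2 hr⟩ e x he hxu
      fun i hi => hxA (Or.inl (Or.inr (Set.mem_iUnion.2 ⟨i, hi⟩)))
  · -- an absorbed arm: a boundary edge of the base
    have hpA : p r ∈ armsAllR (mixedDataR ends h u p ζ).U (mixedDataR ends h u p ζ).Ah
        (mixedDataR ends h u p ζ).F :=
      Or.inl (Or.inl (Set.mem_iUnion.2 ⟨Sum.inr ⟨(r, armC ends h u ζ (p r)),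
        mem_absArmsR_iff.2 ⟨hr, rfl⟩⟩, mem_armC_self (p r)⟩))
    exact hb.bdry_blue e (p r) x he hpA hxh hxu (fun r' => hxp r'.1) hxA

omit [DecidableEq E] hj hl hζ hk in
/-- A u–`p r` class edge is a u–`p` edge. -/
lemma dataUP₀ (r : (mixedDataR ends h u p ζ).ρ') (e : E)
    (he : e ∈ clsUPR ends u ((mixedDataR ends h u p ζ).drop p) r) : ∃ r₀, ends e = s(u, p r₀) :=
  ⟨r.1, he⟩

omit [DecidableEq E] hl hζ hk in
/-- An outside-class edge of a mixed dropped vertex leaves `U`. -/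
lemma dataX₀ (r : (mixedDataR ends h u p ζ).ρ') (e : E)
    (he : e ∈ clsExtR ends u ((mixedDataR ends h u p ζ).drop p) (mixedDataR ends h u p ζ).Ah r) :
    ∃ r₀ x, ends e = s(p r₀, x) ∧ x ∉ U := by
  obtain ⟨x, hx, hxu, hxA⟩ := he
  exact ⟨r.1, x, hx, dataExtU hj r e x hx hxu hxA⟩

omit hl in
/-- Every vertex of a piece has an edge leaving `U` (the mark `o` outside the dropped
components). -/
lemma dataPieceOut (ho : ∀ r, o ∉ compU ends U h u (p r)) (i : (mixedDataR ends h u p ζ).ν) :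
    ∀ y ∈ (mixedDataR ends h u p ζ).Ah i, ∃ e z, ends e = s(y, z) ∧ z ∉ U ∧ z ≠ h ∧ z ≠ u ∧
      (∀ r : (mixedDataR ends h u p ζ).ρ', z ≠ (mixedDataR ends h u p ζ).drop p r) ∧
      z ∉ armsAllR (mixedDataR ends h u p ζ).U (mixedDataR ends h u p ζ).Ah
        (mixedDataR ends h u p ζ).F := by
  intro y hy
  have hHU : extHull ends ζ h u ⊆ U := extHull_subset_of_coreKind hζ hk
  have huU : u ∈ U := hk.2 (Or.inl (mem_cluster_self _ _ _))
  have hyA := dataAh_subset i hy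
  have hyarm : y ∈ armC ends h u ζ (p i.1.1) := hyA.1
  obtain ⟨hyH, hyh, hyu⟩ := armsC_subset (armP_mem_armsC_R hj ζ i.1.1) y hyarm
  have hyo : y ≠ o := by
    rintro rfl
    exact ho i.1.1 (armC_subset_compU hHU (p i.1.1) hyarm)
  rcases hj.hout y (hHU hyH) hyh hyo hyu with ⟨e, z, hez, hzU⟩ | hno
  · refine ⟨e, z, hez, hzU, fun h' => hzU (h' ▸ (mem_outClass.1 (mem_swOutSide.1 hζ).2).2
      (Or.inl (mem_cluster_self _ _ _))), fun h' => hzU (h' ▸ huU),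
      fun r h' => hzU (h' ▸ hHU (p_mem_extHull (hj.hup r.1) ζ)),
      fun hz => hzU (hHU (mem_extHull_of_mem_armsAllR hj hz).1)⟩
  · -- `y` has an edge: it is joined to its dropped vertex inside the arm
    exfalso
    obtain ⟨e, y', hey', hy', hyy'⟩ := exists_dead_of_mem_AhOfR hyA
    by_cases hyy : y = y'
    · exact hno e (by rw [hey', hyy]; exact Sym2.mem_mk_right _ _)
    · -- `y ≠ y'` connected: the path leaves `y` by an edge
      have hcl : cluster ends (fun e => decide (e ∈ within ends (AhOfR ends h u p ζ i.1.1))) y = {y} := by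
        apply Set.Subset.antisymm
        · intro v hv
          refine mem_of_conn_of_closed (ends := ends)
            (ω := fun e => decide (e ∈ within ends (AhOfR ends h u p ζ i.1.1))) ?_ rfl hv
          intro a ha b hab
          obtain ⟨_, e', -, hends⟩ := openGraph_adj.1 hab
          rw [Set.mem_singleton_iff] at ha
          rw [ha] at hends
          exact absurd (by rw [hends]; exact Sym2.mem_mk_left _ _) (hno e')
        · intro v hv
          rw [Set.mem_singleton_iff] at hv
          rw [hv]
          exact mem_cluster_self _ _ _
      have : y' ∈ cluster ends (fun e => decide (e ∈ within ends (AhOfR ends h u p ζ i.1.1))) y :=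
        conn_symm hyy'
      rw [hcl] at this
      exact hyy this.symm

end Data

section Key

variable (ends) (U) (ξ) (l h o u) (p)

/-- The escaping points of the mixed kind: in the block of a core-kind `Q`-point whose data are
the data read off the point. -/
def MixedKindER (ζ : Config E) : Prop :=
  ∃ ζ₀ ∈ swOutSide ends l h o U ξ, CoreKind ends U h u ζ₀ ∧
    mixedDataR ends h u p ζ₀ = mixedDataR ends h u p (baseER ends U h u p ζ) ∧
    ζ ∈ blockR ends u p (mixedDataR ends h u p ζ₀)

/-- The keys: an all-red orientation or a data record. -/
abbrev KeyR (V E ρ : Type*) := Config E ⊕ DataR V E ρ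

/-- The key of a `Q`-point of a several-arms junction class. -/
noncomputable def keyR (ζ : Config E) : KeyR V E ρ :=
  if u ∉ hull ends ζ h then Sum.inl (allRed ends ζ h)
  else if hull ends ζ u ⊆ U then Sum.inr (mixedDataR ends h u p ζ)
  else if MixedKindER ends U ξ l h o u p ζ then
    Sum.inr (mixedDataR ends h u p (baseER ends U h u p ζ))
  else Sum.inl (allRed ends ζ h)

/-- The block of a key: the coarse orbit or the block of the data. -/
noncomputable def blockOfR : KeyR V E ρ → Finset (Config E)
  | Sum.inl ρ' => orbit ends ρ' h
  | Sum.inr d => blockR ends u p d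

variable {ends U ξ l h o u p}

/-- The key of an out point. -/
lemma keyR_of_out {ζ : Config E} (hu : u ∉ hull ends ζ h) :
    keyR ends U ξ l h o u p ζ = Sum.inl (allRed ends ζ h) := by
  simp only [keyR, if_pos hu]

/-- The key of a core-kind point. -/
lemma keyR_of_core {ζ : Config E} (hu : u ∈ hull ends ζ h) (hk : hull ends ζ u ⊆ U) :
    keyR ends U ξ l h o u p ζ = Sum.inr (mixedDataR ends h u p ζ) := by
  simp only [keyR, if_neg (not_not.2 hu), if_pos hk]

/-- The key of an escaping point of the mixed kind. -/
lemma keyR_of_escMixed {ζ : Config E} (hu : u ∈ hull ends ζ h) (hesc : ¬ hull ends ζ u ⊆ U)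
    (hm : MixedKindER ends U ξ l h o u p ζ) :
    keyR ends U ξ l h o u p ζ = Sum.inr (mixedDataR ends h u p (baseER ends U h u p ζ)) := by
  simp only [keyR, if_neg (not_not.2 hu), if_neg hesc, if_pos hm]

/-- The key of an escaping point of the plain kind. -/
lemma keyR_of_plain {ζ : Config E} (hu : u ∈ hull ends ζ h) (hesc : ¬ hull ends ζ u ⊆ U)
    (hm : ¬ MixedKindER ends U ξ l h o u p ζ) :
    keyR ends U ξ l h o u p ζ = Sum.inl (allRed ends ζ h) := by
  simp only [keyR, if_neg (not_not.2 hu), if_neg hesc, if_neg hm]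

omit [DecidableEq E] [Fintype ρ] in
/-- Membership in the block of a data record. -/
lemma mem_blockR {d : DataR V E ρ} {ζ' : Config E} :
    ζ' ∈ blockR ends u p d ↔
      ∃ q : PtR d.ι d.ρ' d.ν d.κ, ¬ Leak q d.arm ∧ mixedRealR ends u d.U (d.drop p) d.Ah d.F d.base q = ζ' := by
  simp only [blockR, blockCRP, Finset.mem_image, Finset.mem_filter, Finset.mem_univ, true_and]

end Key

end MixedArms

end Summit.Ventures.PercRepro2
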